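import Summits.CriticalPhenomena.PercolationContinuityZ3.Theorems.Transplant.DiamondFilmThreeComb
import HarnessLib

/-!
# The comb lattice (= the diamond `(001)`-film of thickness `3`) in the scope of sharpness: locally finite, connected, quasi-transitive under the translations `(2s, t)`

builds on p205010 (kernel theorem, internal audit signed; external expert review pending) — NOT used in this file.
Lane `prim-bschramm`, seat `prim-bschramm-p2` (gen 40; class C1b, METHOD = input substitution; memo `HOME/bschramm/P2-LATTICES.md` §142); helper file
(`--supports stmt-CriticalPhenomena-4575 --as helper`).  First of three files («CombScope», «CombAggregation», «CombCriticalUpperBound») proving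
`p_c(D_3) ≤ (√5 − 1)/2` unconditionally.  Here: the hypotheses of Duminil-Copin–Tassion sharpness for the comb lattice `combGraph` («DiamondFilmThreeComb»: `ℤ²` minus the
vertical bonds of the odd columns) — `Comb.locallyFinite`, **`Comb.connected`**, the automorphisms `Comb.shiftIso s t` (translation by `(2s, t)`), and **`Comb.exists_shiftIso_mem_fund`**
(every site is carried into the fundamental domain `{(0,0), (1,0)}`).
[cite: GrimmettPercolation1999, §11.9 Thm. (11.115)] [cite: DuminilCopinTassionCMP2016, Thm. 1.1] [cite: BenjaminiSchramm1996, Conj. 4 / Question 3]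
-/

noncomputable section

namespace Summit.CriticalPhenomena.PercolationContinuityZ3.Theorems.Transplant

open MeasureTheory Literature.Probability.Percolation Literature.Probability.LatticeModels SimpleGraph
open scoped Classical

namespace Comb

/-! ## §1 The comb lattice in the scope of sharpness: locally finite, connected, quasi-transitive -/

/-- The comb lattice is locally finite (a subgraph of `ℤ²`). [folklore] -/
instance locallyFinite : combGraph.LocallyFinite := fun v =>
  Fintype.ofFinset (((zdGraph 2).neighborFinset v).filter (combGraph.Adj v)) (by
    intro w
    simp only [Finset.mem_filter, SimpleGraph.mem_neighborFinset, SimpleGraph.mem_neighborSet, and_iff_right_iff_imp]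
    exact fun h => combGraph_le_zdGraph h)

/-- A horizontal unit step is a comb bond. [folklore] -/
theorem adj_right (x : Site 2) : combGraph.Adj x (x + Pi.single 0 1) := by
  rw [combGraph_adj_iff]; left; simp

/-- A vertical unit step at an even column is a comb bond. [folklore] -/
theorem adj_up {x : Site 2} (hx : x 0 % 2 = 0) : combGraph.Adj x (x + Pi.single 1 1) := by
  rw [combGraph_adj_iff]; right; right; left; simp [hx]

/-- Every site of the row of `x` is reachable from `x` along the row. [folklore] -/
theorem reachable_row (x : Site 2) (n : ℕ) : combGraph.Reachable x (x + (n : ℤ) • Pi.single 0 1) := by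
  induction n with
  | zero => simp
  | succ n ih =>
    refine ih.trans (SimpleGraph.Adj.reachable ?_)
    have : x + ((n + 1 : ℕ) : ℤ) • (Pi.single 0 1 : Site 2) = (x + (n : ℤ) • Pi.single 0 1) + Pi.single 0 1 := by
      ext i; fin_cases i
      · simp; ring
      · simp
    rw [this]; exact adj_right _

/-- Every site of the column `0` is reachable from its foot along the column. [folklore] -/
theorem reachable_col (x : Site 2) (hx : x 0 % 2 = 0) (n : ℕ) : combGraph.Reachable x (x + (n : ℤ) • Pi.single 1 1) := by
  induction n with
  | zero => simp
  | succ n ih =>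
    refine ih.trans (SimpleGraph.Adj.reachable ?_)
    have : x + ((n + 1 : ℕ) : ℤ) • (Pi.single 1 1 : Site 2) = (x + (n : ℤ) • Pi.single 1 1) + Pi.single 1 1 := by
      ext i; fin_cases i
      · simp
      · simp; ring
    rw [this]
    exact adj_up (by simp [hx])

/-- Two sites of a row are joined along the row. [folklore] -/
theorem reachable_of_row {x y : Site 2} (h : x 1 = y 1) : combGraph.Reachable x y := by
  rcases le_total (x 0) (y 0) with hle | hle
  · obtain ⟨n, hn⟩ := Int.eq_ofNat_of_zero_le (sub_nonneg.2 hle)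
    have : y = x + (n : ℤ) • Pi.single 0 1 := by ext i; fin_cases i <;> simp <;> omega
    rw [this]; exact reachable_row x n
  · obtain ⟨n, hn⟩ := Int.eq_ofNat_of_zero_le (sub_nonneg.2 hle)
    have : x = y + (n : ℤ) • Pi.single 0 1 := by ext i; fin_cases i <;> simp <;> omega
    rw [this]; exact (reachable_row y n).symm

/-- Two sites of the column `0` are joined along it. [folklore] -/
theorem reachable_of_col_zero {x y : Site 2} (hx : x 0 = 0) (hy : y 0 = 0) : combGraph.Reachable x y := by
  rcases le_total (x 1) (y 1) with hle | hle
  · obtain ⟨n, hn⟩ := Int.eq_ofNat_of_zero_le (sub_nonneg.2 hle)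
    have : y = x + (n : ℤ) • Pi.single 1 1 := by ext i; fin_cases i <;> simp <;> omega
    rw [this]; exact reachable_col x (by rw [hx]; rfl) n
  · obtain ⟨n, hn⟩ := Int.eq_ofNat_of_zero_le (sub_nonneg.2 hle)
    have : x = y + (n : ℤ) • Pi.single 1 1 := by ext i; fin_cases i <;> simp <;> omega
    rw [this]; exact (reachable_col y (by rw [hy]; rfl) n).symm

/-- **The comb lattice is connected** (along the row to column `0`, then along column `0`). [folklore] -/
theorem connected : combGraph.Connected := by
  refine ⟨fun x y => ?_⟩
  have h1 : combGraph.Reachable x ![0, x 1] := reachable_of_row (by simp)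
  have h2 : combGraph.Reachable ![0, x 1] ![0, y 1] := reachable_of_col_zero (by simp) (by simp)
  have h3 : combGraph.Reachable ![0, y 1] y := reachable_of_row (by simp)
  exact h1.trans (h2.trans h3)

/-- The translation by `(2s, t)`. [folklore] -/
def shiftVec (s t : ℤ) : Site 2 := ![2 * s, t]

/-- The translation by `(2s, t)` as a bijection. [folklore] -/
def shiftEquiv (s t : ℤ) : Site 2 ≃ Site 2 where
  toFun x := x + shiftVec s t
  invFun x := x - shiftVec s t
  left_inv x := by simp
  right_inv x := by simp

/-- **The translations by `(2s, t)` are automorphisms of the comb lattice** (they preserve the parity of the columns). [folklore] -/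
def shiftIso (s t : ℤ) : combGraph ≃g combGraph where
  toEquiv := shiftEquiv s t
  map_rel_iff' := by
    intro a b
    show combGraph.Adj (a + shiftVec s t) (b + shiftVec s t) ↔ combGraph.Adj a b
    rw [combGraph_adj_iff, combGraph_adj_iff]
    simp only [shiftVec, Pi.add_apply, Matrix.cons_val_zero, Matrix.cons_val_one]
    omega

/-- The fundamental domain `{(0,0), (1,0)}`. [folklore] -/
def fund : Finset (Site 2) := {0, Pi.single 0 1}

/-- **Quasi-transitivity**: every site is carried into the fundamental domain by a translation `(2s, t)`. [folklore] -/
theorem exists_shiftIso_mem_fund (v : Site 2) : ∃ γ : combGraph ≃g combGraph, γ v ∈ fund := by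
  refine ⟨shiftIso (-(v 0 / 2)) (-(v 1)), ?_⟩
  show v + shiftVec (-(v 0 / 2)) (-(v 1)) ∈ fund
  rw [fund, Finset.mem_insert, Finset.mem_singleton]
  rcases Int.emod_two_eq_zero_or_one (v 0) with h | h
  · left; ext i; fin_cases i
    · simp [shiftVec]; omega
    · simp [shiftVec]
  · right; ext i; fin_cases i
    · simp [shiftVec]; omega
    · simp [shiftVec]

end Comb

end Summit.CriticalPhenomena.PercolationContinuityZ3.Theorems.Transplant

end
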